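import Literature.Analysis.Distribution.FourierLaplaceBoundaryValue
import Literature.Analysis.FunctionSpaces.IteratedFDerivParametricIntegral
import Mathlib.Topology.UrysohnsLemma
import HarnessLib

/-!
# The Laplace transform of a compactly supported test function against the Fourier–Laplace kernel

Topic `Literature/Analysis/Distribution`, companion of `FourierLaplaceTransform` /
`FourierLaplaceBoundaryValue`. There the Fourier–Laplace transform of a tempered distribution `u`
supported in a set `S ⊆ ℝ^ι` is `F(z) = u(K_z)` with the Schwartz kernel
`K_z = laplaceKernel S z = χ_S e^{−2πi⟨z, ·⟩}`, `Im z` in the open cone `C = interior S⁻`, and the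
boundary-value pairing `∫ F(x + ity) φ(x) dx = u(∫ φ(x) K_{x+ity} dx)` is computed by factoring the
`x`-integral of the kernels through the Fourier transform of `φ`. This file provides the same
exchange for integrals over *arbitrary* smooth compactly supported densities of points of the
tube, entering through a real-linear map `L : V → ℂ^ι` (the case needed for the Euclidean points
`(i x⁰ₖ, x⃗ₖ)ₖ` of Osterwalder–Schrader, where the imaginary parts vary with the integration
variable and no factorisation through a Fourier transform is available):

* `laplaceDomain S L = {v | Im (L v) ∈ C}` (open), and for `h ∈ C^∞(V)` compactly supported in it
  the **Laplace test function** `laplaceTest S L μ h ∈ 𝓢(ℝ^ι, ℂ)`,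
  `(laplaceTest S L μ h)(ξ) = ∫ h(v) K_{L v}(ξ) dμ(v)` (`laplaceTest_apply`) — smoothness and the
  derivatives under the integral sign from the tree's `ParametricIntegralSmooth` /
  `IteratedFDerivParametricIntegral` (the integrand `h(v) χ_S(ξ) e^{−2πi⟨L v, ξ⟩}` is jointly
  smooth, `contDiff_laplaceIntegrand`), Schwartz decay from the uniform kernel estimate
  `exists_kernel_bound` on the compact set of imaginary parts `Im L(supp h) ⊆ C`;
* **the exchange** `W(laplaceTest S L μ h) = ∫ h(v) W(K_{L v}) dμ(v)` for every tempered
  distribution `W` (`clm_laplaceTest`; Osterwalder–Schrader I (1973), Lemma 8.4, first part, in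
  `ι` variables: "`W(∫ f_x(·) g(x) dx) = ∫ g(x) W(f_x(·)) dx`", `f_x(q) = e^{−qx}`), from the tree's
  `SchwartzMap.apply_eq_integral_of_forall_apply_eq_integral` applied to the continuous,
  compactly supported Schwartz-valued family `v ↦ θ(v) K_{L v}` (`θ` an Urysohn cutoff equal to `1`
  on `supp h` and supported inside the domain, where `z ↦ K_z` is continuous,
  `continuousAt_laplaceKernel`).

## References

* K. Osterwalder, R. Schrader, *Axioms for Euclidean Green's functions*, Comm. Math. Phys. 31
  (1973) 83–112, §8, Lemma 8.4 and the Remark after it ("can immediately be generalized to the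
  case of several variables"); §4.3 eq. (4.20). [OsterwalderSchraderCMP1973]
* L. Hörmander, *The Analysis of Linear Partial Differential Operators I*, 2nd ed., Thm. 7.4.2,
  eq. (7.4.3). [HormanderALPDO1]
-/

noncomputable section

open Set Filter Metric SchwartzMap MeasureTheory
open _root_.Complex (exp I)
open scoped ContDiff Topology RealInnerProductSpace SchwartzMap

namespace Literature.Analysis.Distribution

variable {ι : Type*}
variable {V : Type*} [NormedAddCommGroup V] [NormedSpace ℝ V]

/-! ### Continuity of the kernel on the tube and joint smoothness of the kernel function -/

/-- `imVec` is continuous. [folklore] -/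
theorem continuous_imVec : Continuous (imVec : (ι → ℂ) → EuclideanSpace ℝ ι) :=
  (PiLp.continuous_toLp 2 _).comp
    (continuous_pi fun i => Complex.continuous_im.comp (continuous_apply i))

variable [Fintype ι]

/-- **The kernel is continuous into the Schwartz space at every point of the tube**
`{Im z ∈ interior S⁻}` (from the local Lipschitz estimate `exists_seminorm_laplaceKernel_sub_le`).
[folklore] -/
theorem continuousAt_laplaceKernel (S : Set (EuclideanSpace ℝ ι)) {z : ι → ℂ}
    (hz : imVec z ∈ interior (polarCone S)) : ContinuousAt (laplaceKernel S) z := by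
  obtain ⟨ρ, hρ, -, hK⟩ := exists_seminorm_laplaceKernel_sub_le S hz
  rw [ContinuousAt, (schwartz_withSeminorms ℂ (EuclideanSpace ℝ ι) ℂ).tendsto_nhds]
  intro m ε hε
  obtain ⟨K, hK0, hKw⟩ := hK m
  have hr : 0 < min ρ (ε / (2 * (K + 1))) := lt_min hρ (by positivity)
  filter_upwards [Metric.closedBall_mem_nhds z hr] with z' hz'
  rw [mem_closedBall, dist_eq_norm] at hz'
  have hz'eq : z' = z + (z' - z) := by abel
  rw [schwartzSeminormFamily_apply, hz'eq]
  calc SchwartzMap.seminorm ℂ m.1 m.2 (laplaceKernel S (z + (z' - z)) - laplaceKernel S z)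
      ≤ K * ‖z' - z‖ := hKw _ (hz'.trans (min_le_left _ _))
    _ ≤ K * (ε / (2 * (K + 1))) := by gcongr; exact hz'.trans (min_le_right _ _)
    _ < ε := by
        rw [mul_div_assoc', div_lt_iff₀ (by positivity)]
        nlinarith

/-- **The kernel function is jointly smooth** in the point of the tube and the momentum:
`(z, ξ) ↦ χ_S(ξ) e^{−2πi ∑ zᵢ ξᵢ}` is `C^∞` on `ℂ^ι × ℝ^ι`. [folklore] -/
theorem contDiff_laplaceKernelFun_uncurry (S : Set (EuclideanSpace ℝ ι)) :
    ContDiff ℝ ∞ fun q : (ι → ℂ) × EuclideanSpace ℝ ι => laplaceKernelFun S q.1 q.2 := by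
  have hχ : ContDiff ℝ ∞ fun q : (ι → ℂ) × EuclideanSpace ℝ ι => (coneCutoff S q.2 : ℂ) :=
    (Complex.ofRealCLM.contDiff.comp (contDiff_coneCutoff S)).comp contDiff_snd
  have hE : ContDiff ℝ ∞ fun q : (ι → ℂ) × EuclideanSpace ℝ ι =>
      -(2 * Real.pi * I) * ∑ i, q.1 i * ((q.2 i : ℝ) : ℂ) := by
    refine contDiff_const.mul (ContDiff.sum fun i _ => ?_)
    have h1 : ContDiff ℝ ∞ fun q : (ι → ℂ) × EuclideanSpace ℝ ι => q.1 i :=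
      (contDiff_apply ℝ ℂ i).comp contDiff_fst
    have h2 : ContDiff ℝ ∞ fun q : (ι → ℂ) × EuclideanSpace ℝ ι => ((q.2 i : ℝ) : ℂ) :=
      Complex.ofRealCLM.contDiff.comp ((EuclideanSpace.proj (𝕜 := ℝ) i).contDiff.comp contDiff_snd)
    exact h1.mul h2
  have h : (fun q : (ι → ℂ) × EuclideanSpace ℝ ι => laplaceKernelFun S q.1 q.2) =
      fun q => (coneCutoff S q.2 : ℂ) * exp (-(2 * Real.pi * I) * ∑ i, q.1 i * ((q.2 i : ℝ) : ℂ)) := by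
    funext q
    rw [laplaceKernelFun_apply, expForm_apply]
  rw [h]
  exact hχ.mul (Complex.contDiff_exp.comp hE)

/-! ### The domain and the integrand -/

/-- The set of parameters `v` whose complex point `L v` lies in the tube over the open cone
`interior S⁻` of admissible imaginary parts. [folklore] -/
def laplaceDomain (S : Set (EuclideanSpace ℝ ι)) (L : V →L[ℝ] (ι → ℂ)) : Set V :=
  {v | imVec (L v) ∈ interior (polarCone S)}

/-- Membership in the domain. [folklore] -/
@[simp]
theorem mem_laplaceDomain_iff {S : Set (EuclideanSpace ℝ ι)} {L : V →L[ℝ] (ι → ℂ)} {v : V} :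
    v ∈ laplaceDomain S L ↔ imVec (L v) ∈ interior (polarCone S) := Iff.rfl

/-- The domain is open. [folklore] -/
theorem isOpen_laplaceDomain (S : Set (EuclideanSpace ℝ ι)) (L : V →L[ℝ] (ι → ℂ)) :
    IsOpen (laplaceDomain S L) :=
  isOpen_interior.preimage (continuous_imVec.comp L.continuous)

/-- The integrand `(v, ξ) ↦ h(v) χ_S(ξ) e^{−2πi⟨L v, ξ⟩}` of the Laplace test function. [folklore] -/
def laplaceIntegrand (S : Set (EuclideanSpace ℝ ι)) (L : V →L[ℝ] (ι → ℂ)) (h : V → ℂ) :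
    V × EuclideanSpace ℝ ι → ℂ :=
  fun q => h q.1 * laplaceKernelFun S (L q.1) q.2

/-- Unfolding. [folklore] -/
@[simp]
theorem laplaceIntegrand_apply (S : Set (EuclideanSpace ℝ ι)) (L : V →L[ℝ] (ι → ℂ)) (h : V → ℂ)
    (q : V × EuclideanSpace ℝ ι) : laplaceIntegrand S L h q = h q.1 * laplaceKernelFun S (L q.1) q.2 :=
  rfl

/-- The integrand is jointly smooth for smooth `h`. [folklore] -/
theorem contDiff_laplaceIntegrand (S : Set (EuclideanSpace ℝ ι)) (L : V →L[ℝ] (ι → ℂ)) {h : V → ℂ}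
    (hh : ContDiff ℝ ∞ h) : ContDiff ℝ ∞ (laplaceIntegrand S L h) :=
  (hh.comp contDiff_fst).mul
    ((contDiff_laplaceKernelFun_uncurry S).comp ((L.contDiff.comp contDiff_fst).prodMk contDiff_snd))

/-- The section `ξ ↦ h(v) K(ξ)` has `n`-th derivative `h(v) Dⁿ K(ξ)`. [folklore] -/
theorem iteratedFDeriv_laplaceIntegrand_section (S : Set (EuclideanSpace ℝ ι)) (L : V →L[ℝ] (ι → ℂ))
    (h : V → ℂ) (v : V) (n : ℕ) (ξ : EuclideanSpace ℝ ι) :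
    iteratedFDeriv ℝ n (fun r => laplaceIntegrand S L h (v, r)) ξ =
      h v • iteratedFDeriv ℝ n (laplaceKernelFun S (L v)) ξ := by
  have : (fun r => laplaceIntegrand S L h (v, r)) = h v • laplaceKernelFun S (L v) := by
    funext r; simp [laplaceIntegrand]
  rw [this, iteratedFDeriv_const_smul_apply
    ((contDiff_laplaceKernelFun S (L v)).contDiffAt.of_le (mod_cast le_top))]

/-! ### The Laplace test function -/

variable [FiniteDimensional ℝ V] [MeasurableSpace V] [BorelSpace V]

/-- The Laplace test function as a bare function:
`ξ ↦ ∫ h(v) (laplaceKernel S (L v))(ξ) dμ(v)`. [folklore] -/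
def laplaceTestFun (S : Set (EuclideanSpace ℝ ι)) (L : V →L[ℝ] (ι → ℂ)) (μ : Measure V) (h : V → ℂ) :
    EuclideanSpace ℝ ι → ℂ :=
  fun ξ => ∫ v, h v * laplaceKernel S (L v) ξ ∂μ

omit [FiniteDimensional ℝ V] [BorelSpace V] in
/-- Off the support of `h` the integrand vanishes; on it the Schwartz kernel is the kernel
function, so the Laplace test function is the set integral of `laplaceIntegrand` over
`tsupport h`. [folklore] -/
theorem laplaceTestFun_eq_setIntegral {S : Set (EuclideanSpace ℝ ι)} {L : V →L[ℝ] (ι → ℂ)}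
    (μ : Measure V) {h : V → ℂ} (hsupp : tsupport h ⊆ laplaceDomain S L) (ξ : EuclideanSpace ℝ ι) :
    laplaceTestFun S L μ h ξ = ∫ v in tsupport h, laplaceIntegrand S L h (v, ξ) ∂μ := by
  rw [setIntegral_eq_integral_of_forall_compl_eq_zero (fun v hv => by
    simp [laplaceIntegrand, image_eq_zero_of_notMem_tsupport hv])]
  refine integral_congr_ae (Eventually.of_forall fun v => ?_)
  by_cases hv : v ∈ tsupport h
  · simp [laplaceIntegrand, coe_laplaceKernel (hsupp hv)]
  · simp [laplaceIntegrand, image_eq_zero_of_notMem_tsupport hv]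

section Construction

variable {S : Set (EuclideanSpace ℝ ι)} {L : V →L[ℝ] (ι → ℂ)} {μ : Measure V} {h : V → ℂ}

/-- The Laplace test function is smooth (differentiation under the integral sign over the compact
support). [folklore] -/
theorem contDiff_laplaceTestFun [IsFiniteMeasureOnCompacts μ] (hh : ContDiff ℝ ∞ h)
    (hc : HasCompactSupport h) (hsupp : tsupport h ⊆ laplaceDomain S L) :
    ContDiff ℝ ∞ (laplaceTestFun S L μ h) := by
  haveI : IsFiniteMeasure (μ.restrict (tsupport h)) :=
    isFiniteMeasure_restrict.2 hc.isCompact.measure_lt_top.ne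
  have h1 := Literature.Analysis.FunctionSpaces.contDiff_parametric_integral
    (μ := μ.restrict (tsupport h)) (ι := id) measurable_id hc.isCompact
    (ae_restrict_mem (isClosed_tsupport _).measurableSet) (contDiff_laplaceIntegrand S L hh)
  have heq : laplaceTestFun S L μ h = fun ξ => ∫ v, laplaceIntegrand S L h (id v, ξ) ∂(μ.restrict (tsupport h)) :=
    funext fun ξ => laplaceTestFun_eq_setIntegral μ hsupp ξ
  rw [heq]
  exact h1

/-- **Exponential bound on the derivatives of the Laplace test function**: there are `c > 0` and
constants `Cₙ` with `‖Dⁿ(laplaceTestFun)(ξ)‖ ≤ Cₙ e^{−c‖ξ‖}` (derivatives under the integral sign,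
then the uniform kernel estimate on the compact set `Im L(supp h)` of imaginary parts). [folklore] -/
theorem exists_norm_iteratedFDeriv_laplaceTestFun_le [IsFiniteMeasureOnCompacts μ]
    (hh : ContDiff ℝ ∞ h) (hc : HasCompactSupport h) (hsupp : tsupport h ⊆ laplaceDomain S L) :
    ∃ c : ℝ, 0 < c ∧ ∀ n : ℕ, ∃ C : ℝ, ∀ ξ,
      ‖iteratedFDeriv ℝ n (laplaceTestFun S L μ h) ξ‖ ≤ C * Real.exp (-(c * ‖ξ‖)) := by
  haveI : IsFiniteMeasure (μ.restrict (tsupport h)) :=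
    isFiniteMeasure_restrict.2 hc.isCompact.measure_lt_top.ne
  -- the compact set of imaginary parts
  set M : Set (EuclideanSpace ℝ ι) := (fun v => imVec (L v)) '' tsupport h with hM
  have hMc : IsCompact M := hc.isCompact.image (continuous_imVec.comp L.continuous)
  have hMS : M ⊆ interior (polarCone S) := by
    rintro _ ⟨v, hv, rfl⟩; exact hsupp hv
  obtain ⟨c, A, hc0, hb⟩ := exists_kernel_bound S hMc hMS
  -- a bound for `‖expForm (L v)‖` on the support
  obtain ⟨R, hR⟩ := hc.isCompact.isBounded.subset_closedBall 0
  set κ : ℝ := 2 * Real.pi * Fintype.card ι with hκ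
  set B₀ : ℝ := κ * (‖L‖ * |R|) with hB₀
  have hB₀v : ∀ v ∈ tsupport h, ‖expForm (L v)‖ ≤ B₀ := fun v hv => by
    have h1 := norm_expForm_le (L v)
    have h2 : ‖L v‖ ≤ ‖L‖ * |R| :=
      (L.le_opNorm v).trans (mul_le_mul_of_nonneg_left
        ((mem_closedBall_zero_iff.1 (hR hv)).trans (le_abs_self R)) (norm_nonneg _))
    calc ‖expForm (L v)‖ ≤ 2 * Real.pi * Fintype.card ι * ‖L v‖ := h1
      _ ≤ κ * (‖L‖ * |R|) := by rw [hκ]; gcongr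
  refine ⟨c, hc0, fun n => ?_⟩
  set E : ℝ := 2 ^ n * coneCutoffBound S n * (1 + B₀) ^ n * Real.exp A with hE
  have hE0 : 0 ≤ E := by have := coneCutoffBound_nonneg S n; positivity
  refine ⟨(∫ v, ‖h v‖ ∂(μ.restrict (tsupport h))) * E, fun ξ => ?_⟩
  have heq : laplaceTestFun S L μ h = fun ξ => ∫ v, laplaceIntegrand S L h (id v, ξ) ∂(μ.restrict (tsupport h)) :=
    funext fun ξ => laplaceTestFun_eq_setIntegral μ hsupp ξ
  rw [heq]
  refine (Literature.Analysis.FunctionSpaces.norm_iteratedFDeriv_parametric_integral_le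
    (μ := μ.restrict (tsupport h)) (ι := id) measurable_id hc.isCompact
    (ae_restrict_mem (isClosed_tsupport _).measurableSet) (contDiff_laplaceIntegrand S L hh) n ξ).trans ?_
  -- pointwise bound of the section derivatives
  have hpt : ∀ v, ‖iteratedFDeriv ℝ n (fun r => laplaceIntegrand S L h (id v, r)) ξ‖ ≤
      ‖h v‖ * (E * Real.exp (-(c * ‖ξ‖))) := fun v => by
    rw [id, iteratedFDeriv_laplaceIntegrand_section, norm_smul]
    by_cases hv : v ∈ tsupport h
    · refine mul_le_mul_of_nonneg_left ?_ (norm_nonneg _)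
      refine (hb (L v) ⟨v, hv, rfl⟩ n ξ).trans ?_
      have hCn := coneCutoffBound_nonneg S n
      have h1 : (1 + ‖expForm (L v)‖) ^ n ≤ (1 + B₀) ^ n :=
        pow_le_pow_left₀ (by positivity) (by linarith [hB₀v v hv]) n
      calc 2 ^ n * coneCutoffBound S n * (1 + ‖expForm (L v)‖) ^ n * Real.exp A * Real.exp (-(c * ‖ξ‖))
          ≤ 2 ^ n * coneCutoffBound S n * (1 + B₀) ^ n * Real.exp A * Real.exp (-(c * ‖ξ‖)) := by
            gcongr
        _ = E * Real.exp (-(c * ‖ξ‖)) := by rw [hE]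
    · rw [image_eq_zero_of_notMem_tsupport hv, norm_zero, zero_mul, zero_mul]
  calc ∫ v, ‖iteratedFDeriv ℝ n (fun r => laplaceIntegrand S L h (id v, r)) ξ‖ ∂(μ.restrict (tsupport h))
      ≤ ∫ v, ‖h v‖ * (E * Real.exp (-(c * ‖ξ‖))) ∂(μ.restrict (tsupport h)) := by
        refine integral_mono_of_nonneg (Eventually.of_forall fun v => norm_nonneg _) ?_
          (Eventually.of_forall hpt)
        exact ((hh.continuous.norm.integrable_of_hasCompactSupport hc.norm).integrableOn).mul_const _
    _ = (∫ v, ‖h v‖ ∂(μ.restrict (tsupport h))) * E * Real.exp (-(c * ‖ξ‖)) := by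
        rw [integral_mul_const]; ring

/-- Schwartz decay of the Laplace test function. [folklore] -/
theorem decay_laplaceTestFun [IsFiniteMeasureOnCompacts μ] (hh : ContDiff ℝ ∞ h)
    (hc : HasCompactSupport h) (hsupp : tsupport h ⊆ laplaceDomain S L) (k n : ℕ) :
    ∃ C : ℝ, ∀ ξ, ‖ξ‖ ^ k * ‖iteratedFDeriv ℝ n (laplaceTestFun S L μ h) ξ‖ ≤ C := by
  obtain ⟨c, hc0, hb⟩ := exists_norm_iteratedFDeriv_laplaceTestFun_le (μ := μ) hh hc hsupp
  refine schwartz_decay_of_exp_bound hc0 (fun m => ?_) k n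
  obtain ⟨C, hC⟩ := hb m
  exact ⟨C, 0, fun ξ => by simpa using hC ξ⟩

end Construction

open Classical in
/-- **The Laplace test function** `ξ ↦ ∫ h(v) χ_S(ξ) e^{−2πi⟨L v, ξ⟩} dμ(v)` as a Schwartz function
on `ℝ^ι`, for `h` smooth and compactly supported in `laplaceDomain S L` (and `0` otherwise)
(Osterwalder–Schrader I (1973), §4.3 eq. (4.20), the transform `f ↦ f̃` of a Euclidean test
function, in the coordinates `L`). [cite: OsterwalderSchraderCMP1973, §4.3 eq. (4.20)] -/
def laplaceTest (S : Set (EuclideanSpace ℝ ι)) (L : V →L[ℝ] (ι → ℂ)) (μ : Measure V)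
    [IsFiniteMeasureOnCompacts μ] (h : V → ℂ) : 𝓢(EuclideanSpace ℝ ι, ℂ) :=
  if H : ContDiff ℝ ∞ h ∧ HasCompactSupport h ∧ tsupport h ⊆ laplaceDomain S L then
    ⟨laplaceTestFun S L μ h, contDiff_laplaceTestFun H.1 H.2.1 H.2.2,
      decay_laplaceTestFun H.1 H.2.1 H.2.2⟩
  else 0

variable {S : Set (EuclideanSpace ℝ ι)} {L : V →L[ℝ] (ι → ℂ)} {μ : Measure V}
  [IsFiniteMeasureOnCompacts μ] {h : V → ℂ}

/-- **Pointwise formula**: `(laplaceTest S L μ h)(ξ) = ∫ h(v) (laplaceKernel S (L v))(ξ) dμ(v)`.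
[folklore] -/
theorem laplaceTest_apply (hh : ContDiff ℝ ∞ h) (hc : HasCompactSupport h)
    (hsupp : tsupport h ⊆ laplaceDomain S L) (ξ : EuclideanSpace ℝ ι) :
    laplaceTest S L μ h ξ = ∫ v, h v * laplaceKernel S (L v) ξ ∂μ := by
  rw [laplaceTest, dif_pos ⟨hh, hc, hsupp⟩]
  rfl

/-- The pointwise formula with the kernel function (integrand supported in `tsupport h`).
[folklore] -/
theorem laplaceTest_apply' (hh : ContDiff ℝ ∞ h) (hc : HasCompactSupport h)
    (hsupp : tsupport h ⊆ laplaceDomain S L) (ξ : EuclideanSpace ℝ ι) :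
    laplaceTest S L μ h ξ = ∫ v, h v * laplaceKernelFun S (L v) ξ ∂μ := by
  rw [laplaceTest_apply hh hc hsupp]
  refine integral_congr_ae (Eventually.of_forall fun v => ?_)
  by_cases hv : v ∈ tsupport h
  · simp [coe_laplaceKernel (hsupp hv)]
  · simp [image_eq_zero_of_notMem_tsupport hv]

/-! ### The exchange with a tempered distribution -/

omit [MeasurableSpace V] [BorelSpace V] in
/-- **A continuous cutoff equal to `1` on `supp h` and compactly supported inside the domain**
(Urysohn, between the compact `tsupport h` and a compact neighbourhood inside the open domain).
[folklore] -/
theorem exists_cutoff_laplaceDomain (hc : HasCompactSupport h) (hsupp : tsupport h ⊆ laplaceDomain S L) :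
    ∃ θ : V → ℝ, Continuous θ ∧ (∀ v ∈ tsupport h, θ v = 1) ∧ HasCompactSupport θ ∧
      tsupport θ ⊆ laplaceDomain S L ∧ ∀ v, θ v ∈ Icc (0 : ℝ) 1 := by
  obtain ⟨k, hkc, hkcl, hsk, hkD⟩ :=
    exists_compact_closed_between hc.isCompact (isOpen_laplaceDomain S L) hsupp
  obtain ⟨θ, h1, h0, hθc, h01⟩ := exists_continuous_one_zero_of_isCompact hc.isCompact
    isOpen_interior.isClosed_compl (disjoint_compl_right_iff_subset.2 hsk)
  refine ⟨θ, θ.continuous, fun v hv => h1 hv, hθc, ?_, h01⟩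
  have hsupport : Function.support θ ⊆ interior k := fun v hv => by
    by_contra hv'
    exact hv (h0 hv')
  calc tsupport θ = closure (Function.support θ) := rfl
    _ ⊆ closure (interior k) := closure_mono hsupport
    _ ⊆ k := (closure_mono interior_subset).trans hkcl.closure_subset
    _ ⊆ laplaceDomain S L := hkD

/-- **Tempered distributions commute with the Laplace test integral**
(Osterwalder–Schrader I (1973), Lemma 8.4, first part, several variables):
`W(laplaceTest S L μ h) = ∫ h(v) W(laplaceKernel S (L v)) dμ(v)` for every continuous linear
functional `W` on `𝓢(ℝ^ι, ℂ)`. Proof: the tree's exchange theorem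
`SchwartzMap.apply_eq_integral_of_forall_apply_eq_integral` for the continuous, compactly supported
Schwartz-valued family `v ↦ θ(v) K_{L v}` and the weight `h`. [cite: OsterwalderSchraderCMP1973, Lemma 8.4] -/
theorem clm_laplaceTest (W : 𝓢(EuclideanSpace ℝ ι, ℂ) →L[ℂ] ℂ) (hh : ContDiff ℝ ∞ h)
    (hc : HasCompactSupport h) (hsupp : tsupport h ⊆ laplaceDomain S L) :
    W (laplaceTest S L μ h) = ∫ v, h v * W (laplaceKernel S (L v)) ∂μ := by
  obtain ⟨θ, hθ, hθ1, hθc, hθD, hθ01⟩ := exists_cutoff_laplaceDomain hc hsupp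
  set Ψ : V → 𝓢(EuclideanSpace ℝ ι, ℂ) := fun v => (θ v) • laplaceKernel S (L v) with hΨ
  -- continuity of `Ψ`
  have hΨc : Continuous Ψ := by
    refine continuous_iff_continuousAt.2 fun v₀ => ?_
    by_cases hv₀ : v₀ ∈ tsupport θ
    · exact (hθ.continuousAt).smul
        ((continuousAt_laplaceKernel S (hθD hv₀)).comp L.continuous.continuousAt)
    · have hev : Ψ =ᶠ[𝓝 v₀] fun _ => 0 := by
        filter_upwards [(notMem_tsupport_iff_eventuallyEq.1 hv₀)] with v hv
        simp [hΨ, hv]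
      exact (continuousAt_const.congr (f := fun _ => (0 : 𝓢(EuclideanSpace ℝ ι, ℂ))) hev.symm)
  -- growth of `Ψ`
  have hgrowth : ∀ k n : ℕ, ∃ (C : ℝ) (N : ℕ), ∀ v,
      SchwartzMap.seminorm ℂ k n (Ψ v) ≤ C * (1 + ‖v‖) ^ N := by
    intro k n
    set M : Set (EuclideanSpace ℝ ι) := (fun v => imVec (L v)) '' tsupport θ with hM
    have hMc : IsCompact M := hθc.isCompact.image (continuous_imVec.comp L.continuous)
    have hMS : M ⊆ interior (polarCone S) := by rintro _ ⟨v, hv, rfl⟩; exact hθD hv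
    obtain ⟨D, hD0, hD⟩ := exists_seminorm_laplaceKernel_le S hMc hMS k n
    refine ⟨D * (1 + ‖L‖) ^ n, n, fun v => ?_⟩
    by_cases hv : v ∈ tsupport θ
    · have hθv : |θ v| ≤ 1 := abs_le.2 ⟨by linarith [(hθ01 v).1], (hθ01 v).2⟩
      rw [hΨ]
      dsimp only
      rw [← Complex.coe_smul, map_smul_eq_mul, Complex.norm_real, Real.norm_eq_abs]
      have h1 := hD (L v) ⟨v, hv, rfl⟩
      have h2 : (1 + ‖L v‖) ^ n ≤ ((1 + ‖L‖) * (1 + ‖v‖)) ^ n := by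
        refine pow_le_pow_left₀ (by positivity) ?_ n
        nlinarith [L.le_opNorm v, norm_nonneg L, norm_nonneg v]
      calc |θ v| * SchwartzMap.seminorm ℂ k n (laplaceKernel S (L v))
          ≤ 1 * (D * (1 + ‖L v‖) ^ n) := by gcongr
        _ ≤ D * ((1 + ‖L‖) * (1 + ‖v‖)) ^ n := by rw [one_mul]; gcongr
        _ = D * (1 + ‖L‖) ^ n * (1 + ‖v‖) ^ n := by rw [mul_pow]; ring
    · have : Ψ v = 0 := by simp [hΨ, image_eq_zero_of_notMem_tsupport hv]
      rw [this, map_zero]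
      positivity
  -- the pointwise formula
  have hmul : ∀ v, h v * (θ v : ℂ) = h v := fun v => by
    by_cases hv : v ∈ tsupport h
    · rw [hθ1 v hv]; simp
    · simp [image_eq_zero_of_notMem_tsupport hv]
  have hK : ∀ ξ, laplaceTest S L μ h ξ = ∫ v, h v * Ψ v ξ ∂μ := fun ξ => by
    rw [laplaceTest_apply hh hc hsupp ξ]
    refine integral_congr_ae (Eventually.of_forall fun v => ?_)
    simp only [hΨ, smul_apply, Complex.real_smul, ← mul_assoc, hmul]
  have hwi : ∀ N : ℕ, Integrable (fun v => (1 + ‖v‖) ^ N * ‖h v‖) μ := fun N =>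
    ((continuous_const.add continuous_norm).pow N).mul hh.continuous.norm
      |>.integrable_of_hasCompactSupport (hc.norm.mul_left)
  rw [SchwartzMap.apply_eq_integral_of_forall_apply_eq_integral W Ψ hΨc hgrowth h hh.continuous
    hwi (laplaceTest S L μ h) hK]
  refine integral_congr_ae (Eventually.of_forall fun v => ?_)
  simp only [hΨ]
  rw [W.map_smul_of_tower, Complex.real_smul, ← mul_assoc, hmul]

end Literature.Analysis.Distribution
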